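import Mathlib.LinearAlgebra.SymplecticGroup
import HarnessLib

/-!
# The centraliser `GL*_n` of the standard involution `τ₀ = (−1 0; 0 1)` in `GSp_{2n}`: block-diagonal similitudes
# `(X 0; 0 μᵗX⁻¹)` and their conjugation action (Goresky–Tai 2017, Appendix §19.4)

Goresky–Tai, *Real structures on ordinary abelian varieties*, arXiv:1701.07742, Appendix §19.4 p0044–p0045, print
(verbatim):

> «Let `GL*_n` denote the centralizer of `τ₀` or equivalently, the subgroup of `GSp_{2n}` that is fixed under the
> involution defined by `τ₀`.  It consists of all elements `h = (X 0; 0 Y)` where `XᵗY = μI` for some `μ ≠ 0`.  There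
> is a short exact sequence `1 → GL_n → GL*_n → 𝔾_m → 1` where `GL_n` is identified with its image under the standard
> embedding `δ : GL_n ↪ GSp_{2n}` given by `δ(A) = (A 0; 0 ᵗA⁻¹)`.  If `h = (X 0; 0 μᵗX⁻¹) ∈ GL*_n` and if
> `γ = (A B; C D) ∈ GSp_{2n}` then conjugation by `h` is given by:
> `hγh⁻¹ = (XAX⁻¹ (1/μ)XBᵗX; μᵗX⁻¹CX⁻¹ ᵗX⁻¹DᵗX)`.»

(`τ₀ = (−I_n 0; 0 I_n)`, §19.1; the multiplier `μ` of `h ∈ GSp_{2n}`: `ᵗhJh = μJ`, §19.1.)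

## What is formalized (matrices over a commutative ring `R`, index `n`; `J = Matrix.J n R = (0 −1; 1 0)`)

* `fromBlocks_mul_tau0_eq_tau0_mul_iff` — «the centralizer of `τ₀`»: `(A B; C D)` commutes with `τ₀ = (−1 0; 0 1)`
  iff `−B = B` and `−C = C`; `fromBlocks_mul_tau0_eq_tau0_mul_iff_of_two_ne_zero` — over a ring without zero
  divisors and with `2 ≠ 0`, iff `B = 0` and `C = 0` («It consists of all elements `h = (X 0; 0 Y)` …»);
* `transpose_blockDiagonal_mul_J_mul_blockDiagonal` (`ᵗhJh = (0 −ᵗXY; ᵗYX 0)` for `h = (X 0; 0 Y)`),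
  `blockDiagonal_multiplier_iff` («… where `XᵗY = μI`», in the `ᵗhJh = μJ` convention: iff `ᵗXY = μ1 = ᵗYX`),
  `blockDiagonal_smul_transpose_multiplier` (`h = (X 0; 0 μᵗX⁻¹)` has multiplier `μ`);
* the short exact sequence `1 → GL_n → GL*_n → 𝔾_m → 1` as three matrix facts: `delta_multiplier_one`
  (`δ(A) = (A 0; 0 ᵗA⁻¹)` has multiplier `1`), `eq_delta_of_multiplier_one` (a block-diagonal `(X 0; 0 Y)` of
  multiplier `1` with `X` invertible is `δ(X)`: `Y = ᵗX⁻¹`), `multiplier_surjective` (`(1 0; 0 μ1)` has multiplier `μ`);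
* ★ `blockDiagonal_conj_fromBlocks` — the displayed conjugation formula
  `hγh⁻¹ = (XAX⁻¹ μ⁻¹XBᵗX; μᵗX⁻¹CX⁻¹ ᵗX⁻¹DᵗX)` (a polynomial identity once the inverses are named:
  `X′ = X⁻¹`, `μ′ = μ⁻¹` with `μμ′ = 1`, `h⁻¹ = (X′ 0; 0 μ′ᵗX)`), and `blockDiagonal_mul_inv_eq_one` (`hh⁻¹ = 1` when
  `XX′ = 1`, `μμ′ = 1`).

THEOREMS ONLY; no definition, instance, notation or named fact.

## References

* [GoreskyTai2017RealStructuresOrdinary] M. Goresky, Y.-S. Tai, *Real structures on ordinary abelian varieties*,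
  arXiv:1701.07742 (2017), Appendix §19.1 (`τ₀`, multiplier) and §19.4 (`GL*_n`, the conjugation formula).
-/

noncomputable section

open Matrix

namespace Literature.LinearAlgebra.Matrix

variable {R : Type*} [CommRing R] {n : Type*} [Fintype n] [DecidableEq n]

/-! ## §1 The centraliser of `τ₀ = (−1 0; 0 1)` -/

/-- **«`GL*_n` … the centralizer of `τ₀`»**: `(A B; C D)τ₀ = τ₀(A B; C D)` iff `−B = B` and `−C = C`
(`τ₀ = (−1 0; 0 1)`). [cite: GoreskyTai2017RealStructuresOrdinary, App. §19.4] -/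
theorem fromBlocks_mul_tau0_eq_tau0_mul_iff (A B C D : Matrix n n R) :
    fromBlocks A B C D * fromBlocks (-1 : Matrix n n R) 0 0 1 = fromBlocks (-1 : Matrix n n R) 0 0 1 * fromBlocks A B C D ↔
      -B = B ∧ -C = C := by
  rw [fromBlocks_multiply, fromBlocks_multiply]
  simp only [Matrix.mul_neg, Matrix.mul_one, Matrix.mul_zero, add_zero, zero_add, Matrix.neg_mul, Matrix.one_mul,
    Matrix.zero_mul, fromBlocks_inj, true_and, and_true]
  exact ⟨fun ⟨hB, hC⟩ => ⟨hB.symm, hC⟩, fun ⟨hB, hC⟩ => ⟨hB.symm, hC⟩⟩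

omit [Fintype n] [DecidableEq n] in
/-- `−B = B ⟺ B = 0` for matrices over a ring with no zero divisors and `2 ≠ 0`. [folklore] -/
private theorem neg_eq_self_iff_eq_zero [NoZeroDivisors R] (h2 : (2 : R) ≠ 0) {m : Type*} (B : Matrix m n R) :
    -B = B ↔ B = 0 := by
  constructor
  · intro h
    ext i j
    have hij : -B i j = B i j := by rw [← Matrix.neg_apply, h]
    have h2b : (2 : R) * B i j = 0 := by rw [two_mul]; nth_rw 1 [← hij]; rw [neg_add_cancel]
    exact (mul_eq_zero.1 h2b).resolve_left h2
  · rintro rfl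
    exact neg_zero

/-- **«It consists of all elements `h = (X 0; 0 Y)` …»**: over a ring without zero divisors and with `2 ≠ 0`, a
block matrix commutes with `τ₀` iff its off-diagonal blocks vanish.
[cite: GoreskyTai2017RealStructuresOrdinary, App. §19.4] -/
theorem fromBlocks_mul_tau0_eq_tau0_mul_iff_of_two_ne_zero [NoZeroDivisors R] (h2 : (2 : R) ≠ 0)
    (A B C D : Matrix n n R) :
    fromBlocks A B C D * fromBlocks (-1 : Matrix n n R) 0 0 1 = fromBlocks (-1 : Matrix n n R) 0 0 1 * fromBlocks A B C D ↔
      B = 0 ∧ C = 0 := by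
  rw [fromBlocks_mul_tau0_eq_tau0_mul_iff, neg_eq_self_iff_eq_zero h2, neg_eq_self_iff_eq_zero h2]

/-! ## §2 The multiplier of a block-diagonal matrix; `1 → GL_n → GL*_n → 𝔾_m → 1` -/

/-- `ᵗhJh` for `h = (X 0; 0 Y)`: `= (0 −ᵗXY; ᵗYX 0)` (`J = (0 −1; 1 0)`).
[cite: GoreskyTai2017RealStructuresOrdinary, App. §19.1 (multiplier `ᵗhJh = μJ`) and §19.4] -/
theorem transpose_blockDiagonal_mul_J_mul_blockDiagonal (X Y : Matrix n n R) :
    (fromBlocks X 0 0 Y)ᵀ * Matrix.J n R * fromBlocks X 0 0 Y = fromBlocks 0 (-(Xᵀ * Y)) (Yᵀ * X) 0 := by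
  rw [Matrix.J, fromBlocks_transpose, fromBlocks_multiply, fromBlocks_multiply]
  simp

/-- **«… where `XᵗY = μI`»** (multiplier convention `ᵗhJh = μJ` of §19.1): `h = (X 0; 0 Y)` satisfies `ᵗhJh = μJ`
iff `ᵗXY = μ·1` and `ᵗYX = μ·1`. [cite: GoreskyTai2017RealStructuresOrdinary, App. §19.4] -/
theorem blockDiagonal_multiplier_iff (X Y : Matrix n n R) (μ : R) :
    (fromBlocks X 0 0 Y)ᵀ * Matrix.J n R * fromBlocks X 0 0 Y = μ • Matrix.J n R ↔
      Xᵀ * Y = μ • (1 : Matrix n n R) ∧ Yᵀ * X = μ • (1 : Matrix n n R) := by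
  rw [transpose_blockDiagonal_mul_J_mul_blockDiagonal, Matrix.J, fromBlocks_smul, fromBlocks_inj, smul_zero,
    smul_neg, neg_inj]
  constructor
  · rintro ⟨-, hXY, hYX, -⟩
    exact ⟨hXY, hYX⟩
  · rintro ⟨hXY, hYX⟩
    exact ⟨rfl, hXY, hYX, rfl⟩

/-- **`h = (X 0; 0 μᵗX⁻¹) ∈ GL*_n` has multiplier `μ`** (with an explicit left inverse `X′`, `X′X = 1`).
[cite: GoreskyTai2017RealStructuresOrdinary, App. §19.4] -/
theorem blockDiagonal_smul_transpose_multiplier {X X' : Matrix n n R} (hX'X : X' * X = 1) (μ : R) :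
    (fromBlocks X 0 0 (μ • X'ᵀ))ᵀ * Matrix.J n R * fromBlocks X 0 0 (μ • X'ᵀ) = μ • Matrix.J n R := by
  rw [blockDiagonal_multiplier_iff, Matrix.mul_smul, ← transpose_mul, hX'X, transpose_one, transpose_smul,
    transpose_transpose, Matrix.smul_mul, hX'X]
  exact ⟨rfl, rfl⟩

/-- **`δ(A) = (A 0; 0 ᵗA⁻¹)` has multiplier `1`** («`GL_n` is identified with its image under the standard
embedding `δ`»; explicit inverse `A′`). [cite: GoreskyTai2017RealStructuresOrdinary, App. §19.4] -/
theorem delta_multiplier_one {A A' : Matrix n n R} (hA'A : A' * A = 1) :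
    (fromBlocks A 0 0 A'ᵀ)ᵀ * Matrix.J n R * fromBlocks A 0 0 A'ᵀ = Matrix.J n R := by
  have h := blockDiagonal_smul_transpose_multiplier hA'A 1
  rwa [one_smul, one_smul] at h

/-- **Exactness at `GL*_n`**: a block-diagonal `h = (X 0; 0 Y)` of multiplier `1` with `X` invertible is
`δ(X)`, i.e. `Y = ᵗX⁻¹` («`1 → GL_n → GL*_n → 𝔾_m → 1`»). [cite: GoreskyTai2017RealStructuresOrdinary, App. §19.4] -/
theorem eq_delta_of_multiplier_one {X X' Y : Matrix n n R} (hXX' : X * X' = 1)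
    (h : (fromBlocks X 0 0 Y)ᵀ * Matrix.J n R * fromBlocks X 0 0 Y = Matrix.J n R) : Y = X'ᵀ := by
  have h1 : (fromBlocks X 0 0 Y)ᵀ * Matrix.J n R * fromBlocks X 0 0 Y = (1 : R) • Matrix.J n R := by
    rw [one_smul]; exact h
  obtain ⟨hXY, -⟩ := (blockDiagonal_multiplier_iff X Y 1).1 h1
  rw [one_smul] at hXY
  calc Y = X'ᵀ * (Xᵀ * Y) := by rw [← Matrix.mul_assoc, ← transpose_mul, hXX', transpose_one, Matrix.one_mul]
    _ = X'ᵀ := by rw [hXY, Matrix.mul_one]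

/-- **Exactness at `𝔾_m`**: the multiplier is onto — `(1 0; 0 μ1) ∈ GL*_n` has multiplier `μ`
(«`1 → GL_n → GL*_n → 𝔾_m → 1`»). [cite: GoreskyTai2017RealStructuresOrdinary, App. §19.4] -/
theorem multiplier_surjective (μ : R) :
    (fromBlocks (1 : Matrix n n R) 0 0 (μ • (1 : Matrix n n R)))ᵀ * Matrix.J n R *
        fromBlocks (1 : Matrix n n R) 0 0 (μ • (1 : Matrix n n R)) = μ • Matrix.J n R := by
  have h := blockDiagonal_smul_transpose_multiplier (X := (1 : Matrix n n R)) (X' := 1) (Matrix.mul_one 1) μ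
  rwa [transpose_one] at h

/-! ## §3 The conjugation formula -/

/-- `hh⁻¹ = 1` for `h = (X 0; 0 μᵗX⁻¹)`, `h⁻¹ = (X′ 0; 0 μ′ᵗX)` (`XX′ = 1`, `μμ′ = 1`).
[cite: GoreskyTai2017RealStructuresOrdinary, App. §19.4] -/
theorem blockDiagonal_mul_inv_eq_one {X X' : Matrix n n R} (hXX' : X * X' = 1) {μ μ' : R} (hμ : μ * μ' = 1) :
    fromBlocks X 0 0 (μ • X'ᵀ) * fromBlocks X' 0 0 (μ' • Xᵀ) = 1 := by
  have hμ' : μ' * μ = 1 := by rw [mul_comm]; exact hμ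
  rw [fromBlocks_multiply, ← fromBlocks_one]
  simp only [Matrix.mul_zero, Matrix.zero_mul, add_zero, zero_add, hXX', Matrix.smul_mul, Matrix.mul_smul,
    smul_smul, smul_zero, ← transpose_mul, transpose_one, hμ', one_smul]

omit [DecidableEq n] in
/-- **Goresky–Tai 2017, §19.4, the displayed conjugation formula**: for `h = (X 0; 0 μᵗX⁻¹) ∈ GL*_n` and
`γ = (A B; C D)`, `hγh⁻¹ = (XAX⁻¹ (1/μ)XBᵗX; μᵗX⁻¹CX⁻¹ ᵗX⁻¹DᵗX)` — with explicit inverses `X′ = X⁻¹`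
(`XX′ = X′X = 1`) and `μ′ = μ⁻¹` (`μμ′ = 1`), `h⁻¹ = (X′ 0; 0 μ′ᵗX)`.
[cite: GoreskyTai2017RealStructuresOrdinary, App. §19.4 (displayed formula for `hγh⁻¹`)] -/
theorem blockDiagonal_conj_fromBlocks {X X' : Matrix n n R} {μ μ' : R} (hμ : μ * μ' = 1)
    (A B C D : Matrix n n R) :
    fromBlocks X 0 0 (μ • X'ᵀ) * fromBlocks A B C D * fromBlocks X' 0 0 (μ' • Xᵀ) =
      fromBlocks (X * A * X') (μ' • (X * B * Xᵀ)) (μ • (X'ᵀ * C * X')) (X'ᵀ * D * Xᵀ) := by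
  have hμ' : μ' * μ = 1 := by rw [mul_comm]; exact hμ
  rw [fromBlocks_multiply, fromBlocks_multiply]
  simp only [Matrix.mul_zero, Matrix.zero_mul, add_zero, zero_add, Matrix.smul_mul, Matrix.mul_smul, smul_smul,
    hμ', one_smul, Matrix.mul_assoc]

end Literature.LinearAlgebra.Matrix
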